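import Mathlib.NumberTheory.NumberField.Cyclotomic.Ideal
import Literature.IUT.LogVolume.InitialThetaDataBadPlaceRamification
import Literature.IUT.LogVolume.DifferentConductorTower
import HarnessLib

/-!
# A number field containing a primitive `p`-th root of unity is ramified of index divisible by `p − 1` over `p`

`Proofs` file (theorems only, no definition, no named fact). Washington, *Introduction to Cyclotomic Fields* (GTM 83),
Prop. 2.1 / Lemma 1.4 (`p` is totally ramified in `ℚ(ζ_p)`, `(p) = (1 − ζ_p)^{p−1}`); Neukirch, *Algebraic Number Theory*,
Ch. I (10.1) and Ch. II (6.8) (multiplicativity of ramification indices in towers). Mathlib: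
`IsCyclotomicExtension.Rat.ramificationIdx_eq_of_prime` (every prime of `ℚ(ζ_p)` over `p` has `e = p − 1`).

* `Literature.NumberTheory.NumberFields.sub_one_dvd_ramificationIdx_of_isPrimitiveRoot` — for a number field `F`
  containing a primitive `p`-th root of unity `ζ` (`p` prime) and a finite place `w` of `F` over `p`:
  **`(p − 1) ∣ e(w | p)`** (tower `ℤ ⊆ 𝓞_{ℚ(ζ)} ⊆ 𝓞_F`: `e(w | p) = e(w ∩ ℚ(ζ) | p) · e(w | w ∩ ℚ(ζ)) = (p−1) · e(w | w ∩ ℚ(ζ))`).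

Consumer: the abc-iut R-W «WILD LOCAL-TYPE» at `p ∈ {3, 5}` (the `F`-layer of a genuine Θ-volume datum contains `μ_{30}` by
the Weil pairing, so `2 ∣ e(w | 3)` and `4 ∣ e(w | 5)`). Classical algebraic number theory.

## References
* [Washington1997] L. C. Washington, *Introduction to Cyclotomic Fields*, 2nd ed. (1997), Lemma 1.4, Prop. 2.1.
* [NeukirchANT1999] J. Neukirch, *Algebraic Number Theory* (1999), Ch. I (10.1), Ch. II Prop. (6.8).
-/

noncomputable section

open scoped NumberField

namespace Literature.NumberTheory.NumberFields

open NumberField IsDedekindDomain Literature.IUT.LogVolume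

/-- **`ζ_p ∈ F` ⟹ `(p − 1) ∣ e(w | p)`** for every finite place `w` of the number field `F` over the prime `p`: the
subfield `ℚ(ζ_p) ⊆ F` is the `p`-th cyclotomic field, in which `p` is totally ramified of index `p − 1`
(Mathlib `IsCyclotomicExtension.Rat.ramificationIdx_eq_of_prime`), and ramification indices multiply in the tower
`ℤ ⊆ 𝓞_{ℚ(ζ_p)} ⊆ 𝓞_F` (the tree's `ThetaData.absRamificationIdx_eq_ramIdx_mul`).
[cite: Washington1997, Lemma 1.4 and Prop. 2.1] [cite: NeukirchANT1999, Ch. II Prop. (6.8)] -/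
theorem sub_one_dvd_ramificationIdx_of_isPrimitiveRoot {F : Type} [Field F] [NumberField F] {p : ℕ}
    (hp : p.Prime) {ζ : F} (hζ : IsPrimitiveRoot ζ p) (w : HeightOneSpectrum (𝓞 F))
    (hw : ((p : ℕ) : 𝓞 F) ∈ w.asIdeal) :
    (p - 1) ∣ w.asIdeal.ramificationIdx ℤ := by
  haveI : Fact p.Prime := ⟨hp⟩
  haveI : NeZero p := ⟨hp.ne_zero⟩
  -- the cyclotomic subfield `K₀ = ℚ(ζ) ⊆ F`
  set K₀ : IntermediateField ℚ F := IntermediateField.adjoin ℚ {ζ} with hK₀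
  haveI : IsCyclotomicExtension {p} ℚ K₀ := hζ.intermediateField_adjoin_isCyclotomicExtension ℚ
  -- the place of `K₀` under `w` lies over `p`
  set v₀ : HeightOneSpectrum (𝓞 K₀) := w.under (𝓞 K₀) with hv₀
  have hpv₀ : ((p : ℕ) : 𝓞 K₀) ∈ v₀.asIdeal := by
    change ((p : ℕ) : 𝓞 K₀) ∈ w.asIdeal.comap (algebraMap (𝓞 K₀) (𝓞 F))
    rw [Ideal.mem_comap, map_natCast]
    exact hw
  haveI := v₀.isPrime
  haveI : v₀.asIdeal.LiesOver (Ideal.span {(p : ℤ)}) := by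
    refine ⟨?_⟩
    have hpr : Prime (p : ℤ) := Nat.prime_iff_prime_int.mp hp
    have hmax : (Ideal.span {(p : ℤ)}).IsMaximal :=
      ((Ideal.span_singleton_prime hpr.ne_zero).mpr hpr).isMaximal (by
        rw [Ne, Ideal.span_singleton_eq_bot]; exact hpr.ne_zero)
    have hle : Ideal.span {(p : ℤ)} ≤ v₀.asIdeal.under ℤ := by
      rw [Ideal.span_le, Set.singleton_subset_iff, SetLike.mem_coe, Ideal.mem_comap, map_natCast]
      exact hpv₀
    have hne : v₀.asIdeal.under ℤ ≠ ⊤ := Ideal.IsPrime.ne_top inferInstance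
    exact hmax.eq_of_le hne hle
  have hram : ramIdx K₀ v₀ = p - 1 := by
    rw [ramIdx_eq]
    exact IsCyclotomicExtension.Rat.ramificationIdx_eq_of_prime p K₀ v₀.asIdeal
  rw [ThetaData.absRamificationIdx_eq_ramIdx_mul (F := K₀) w, ← hv₀, hram]
  exact dvd_mul_right _ _

end Literature.NumberTheory.NumberFields

end
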